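import Summits.NavierStokesRegularity.NavierStokesRegularity.Theorems.LerayQuarterDissipationFiniteDissipationLiouvilleApexPressure
import Summits.NavierStokesRegularity.NavierStokesRegularity.Theorems.LerayQuarterDissipationFiniteDissipationLiouvilleSliceHolder
import Literature.Analysis.FluidPDE.PressureNormalisationLq
import HarnessLib

/-!
# Crux `FiniteDissipationLiouville` (stmt-NavierStokesRegularity-22144): tools for FAR-FIELD
# REGULARITY THROUGH THE SINGULAR TIME (file 1/2)

Theorems file of route `LerayQuarterDissipation` (lead prover g4; `--supports` the crux). Navier–Stokes
regularity is NOT proved by anything here; no summit is.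

The far-field theorem (file 2/2, `…FarField.lean`): every member `u` of the finite-dissipation
stratum `𝒟_{C,K}` is BOUNDED on `(−r², 0) × {|x| ≥ R₀}` for some `r, R₀` — so, with the finite
singular set (`…FiniteSingularSet.lean`), Type-I dissipation-law blow-up is confined to finitely many
points, uniformly up to the singular time and out to spatial infinity. The proof applies the
one-scale ε-regularity criterion at the final time (`exists_epsilon_apex`, from the tree's proved
Lemarié-Rieusset Thm. 14.4) on cylinders `Q_r(0, x₀)` with `|x₀| → ∞`, for the pressure gauged BY A
LOCAL AVERAGE AROUND `x₀` (`p_{x₀} = p₀ − m_{x₀}`, a smooth function of time, so `(u, p_{x₀})` stays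
classical): then BOTH the Calderón–Zygmund part and the gauge constant of the slice pressure are
controlled by the `L³` norm of the Riesz pressure `Q(t)` NEAR `x₀`, which tends to `0` at spatial
infinity, slice by slice. This file holds the slice-wise tools:

* `abs_normaliser_sub_const_le_local` — the local form of lead g3's `abs_normaliser_sub_const_le`:
  `|m_{x₀} − C| ≤ B_Θ ∫_{B̄(x₀,ρ)} |Q|`.
* `enorm_normaliser_sub_const_le` — the same in `ℝ≥0∞` against the LOCAL `L³` norm:
  `‖m_{x₀} − C‖ₑ ≤ B_Θ |B̄_ρ|^{2/3} ‖Q‖_{L³(B̄(x₀,ρ))}`.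
* `setLIntegral_cube_add_pressure_le_local` — the local slice estimate
  `∫_E (|v|³ + |pr|^{3/2}) ≤ ‖v‖³_{L⁶(E)} |E|^{1/2} + √2 (‖Q‖^{3/2}_{L³(E)} |E|^{1/2} + |c|^{3/2} |E|)`.
* `measurable_extendByZero_of_continuousOn`, `measurable_lintegral_ball` — measurability in time
  of the slice functionals (for dominated convergence in time).
-/

noncomputable section

-- the summit and its single sub-problem share the name (CONVENTIONS §1), as in every Theorems file
set_option linter.dupNamespace false

namespace Summit.NavierStokesRegularity.NavierStokesRegularity.Theorems.FiniteDissipationLiouville.Birth.Apex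

open MeasureTheory Set Filter Topology Metric Function TopologicalSpace
open Literature.Analysis Literature.Analysis.FluidPDE
open Literature.Analysis.FluidPDE.PressureNormalisationL3 (norm_integral_le_of_kernel_bound)
open scoped ENNReal NNReal

/-! ### The local form of the normaliser bound -/

/-- **The local average of a gauged slice pressure is the gauge constant up to a LOCAL error.**
If `pr = Q + c` a.e. with `Q` locally integrable and `Θ` is a normed bump of outer radius `ρ` with
`Θ ≤ B_Θ`, then `|∫ Θ(y) pr(x₀ − y) dy − c| ≤ B_Θ ∫_{B̄(x₀, ρ)} |Q|` (lead g3's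
`abs_normaliser_sub_const_le` stops one Hölder step earlier). -/
theorem abs_normaliser_sub_const_le_local (x₀ : EuclideanSpace ℝ (Fin 3))
    (θ : ContDiffBump (0 : EuclideanSpace ℝ (Fin 3))) {BΘ : ℝ} (hBΘ : ∀ y, θ.normed volume y ≤ BΘ)
    {pr Q : EuclideanSpace ℝ (Fin 3) → ℝ} (hQloc : LocallyIntegrable Q volume)
    (hQm : AEStronglyMeasurable Q volume) {c : ℝ}
    (hae : ∀ᵐ x ∂(volume : Measure (EuclideanSpace ℝ (Fin 3))), pr x = Q x + c) :
    |(∫ y, θ.normed volume y * pr (x₀ - y)) - c| ≤ BΘ * ∫ y in closedBall x₀ θ.rOut, |Q y| := by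
  set ρ := θ.rOut with hρ
  set Θ := θ.normed volume with hΘ
  have hΘc : Continuous Θ := θ.continuous_normed
  have hΘcs : HasCompactSupport Θ := θ.hasCompactSupport_normed
  set cQ : ℝ := ∫ y, Θ y * Q (x₀ - y) with hcQ
  have iQ : Integrable (fun y => Θ y * Q (x₀ - y)) volume :=
    (hΘcs.convolutionExists_left (ContinuousLinearMap.lsmul ℝ ℝ : ℝ →L[ℝ] ℝ →L[ℝ] ℝ) hΘc hQloc x₀).integrable
  have hae' : ∀ᵐ y ∂(volume : Measure (EuclideanSpace ℝ (Fin 3))), pr (x₀ - y) = Q (x₀ - y) + c :=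
    ((volume : Measure (EuclideanSpace ℝ (Fin 3))).measurePreserving_sub_left x₀).quasiMeasurePreserving.ae hae
  have hm' : (∫ y, Θ y * pr (x₀ - y)) = cQ + c := by
    calc ∫ y, Θ y * pr (x₀ - y) = ∫ y, (Θ y * Q (x₀ - y) + c * Θ y) := by
          refine integral_congr_ae ?_
          filter_upwards [hae'] with y hy
          rw [hy]; ring
      _ = cQ + c * ∫ y, Θ y := by
          rw [integral_add iQ (θ.integrable_normed.const_mul c), integral_const_mul]
      _ = cQ + c := by rw [hΘ, θ.integral_normed, mul_one]
  rw [hm', add_sub_cancel_right]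
  rw [hcQ, ← integral_sub_left_eq_self (fun y => Θ y * Q (x₀ - y)) volume x₀]
  simp only [sub_sub_cancel]
  have hF : ∀ y, ‖Θ (x₀ - y) * Q y‖ ≤ BΘ * |Q y| := fun y => by
    rw [norm_mul, Real.norm_of_nonneg (θ.nonneg_normed _), Real.norm_eq_abs]
    exact mul_le_mul_of_nonneg_right (hBΘ _) (abs_nonneg _)
  have hF0 : ∀ y, ρ < dist y x₀ → Θ (x₀ - y) * Q y = 0 := fun y hy => by
    have : Θ (x₀ - y) = 0 := by
      have hns : x₀ - y ∉ Function.support Θ := by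
        rw [hΘ, θ.support_normed_eq, mem_ball_zero_iff, not_lt, ← dist_eq_norm, dist_comm]
        exact hy.le
      simpa [Function.mem_support] using hns
    rw [this, zero_mul]
  have hFm : AEStronglyMeasurable (fun y => Θ (x₀ - y) * Q y) volume :=
    ((hΘc.comp (continuous_const.sub continuous_id)).aestronglyMeasurable).mul hQm
  obtain ⟨-, hI⟩ := norm_integral_le_of_kernel_bound
    ((hQloc.integrableOn_isCompact (isCompact_closedBall x₀ ρ)).abs) hFm hF hF0
  rw [← Real.norm_eq_abs]
  exact hI

/-- **The gauge constant against the LOCAL `L³` norm of the Riesz pressure**, in `ℝ≥0∞`: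
`‖(∫ Θ(y) pr(x₀ − y) dy) − c‖ₑ ≤ B_Θ · |B̄(x₀,ρ)|^{2/3} · ‖Q‖_{L³(B̄(x₀,ρ))}` for `Q ∈ L³`. -/
theorem enorm_normaliser_sub_const_le (x₀ : EuclideanSpace ℝ (Fin 3))
    (θ : ContDiffBump (0 : EuclideanSpace ℝ (Fin 3))) {BΘ : ℝ} (hBΘ : ∀ y, θ.normed volume y ≤ BΘ)
    {pr Q : EuclideanSpace ℝ (Fin 3) → ℝ} (hQ : MemLp Q 3 volume) {c : ℝ}
    (hae : ∀ᵐ x ∂(volume : Measure (EuclideanSpace ℝ (Fin 3))), pr x = Q x + c) :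
    ‖(∫ y, θ.normed volume y * pr (x₀ - y)) - c‖ₑ ≤
      ENNReal.ofReal (BΘ * (volume.real (closedBall x₀ θ.rOut)) ^ (2 / 3 : ℝ)) *
        eLpNorm Q 3 (volume.restrict (closedBall x₀ θ.rOut)) := by
  have hBΘ0 : 0 ≤ BΘ := (θ.nonneg_normed 0).trans (hBΘ 0)
  have hQloc : LocallyIntegrable Q volume := hQ.locallyIntegrable (by norm_num)
  have h1 := abs_normaliser_sub_const_le_local x₀ θ hBΘ hQloc hQ.1 hae
  -- the local `L³` norm as the norm of the truncation
  set B := closedBall x₀ θ.rOut with hB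
  have hfin : eLpNorm Q 3 (volume.restrict B) < ⊤ := (hQ.restrict B).eLpNorm_lt_top
  set M : ℝ≥0 := (eLpNorm Q 3 (volume.restrict B)).toNNReal with hM
  have hMeq : (M : ℝ≥0∞) = eLpNorm Q 3 (volume.restrict B) := ENNReal.coe_toNNReal hfin.ne
  have hind : eLpNorm (B.indicator Q) 3 volume ≤ M := by
    rw [eLpNorm_indicator_eq_eLpNorm_restrict measurableSet_closedBall, hMeq]
  have h2 := PressureNormalisation.setIntegral_norm_le_of_eLpNorm_le
    (hQ.1.indicator measurableSet_closedBall) (r := 3) (by norm_num) (by norm_num) hind x₀ θ.rOut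
  have h3 : ∫ y in B, |Q y| = ∫ y in closedBall x₀ θ.rOut, ‖B.indicator Q y‖ := by
    refine setIntegral_congr_fun measurableSet_closedBall fun y hy => ?_
    rw [indicator_of_mem hy, Real.norm_eq_abs]
  have e3 : (1 - (3 : ℝ≥0∞).toReal⁻¹) = (2 / 3 : ℝ) := by norm_num
  rw [e3] at h2
  rw [← hB, ← h3] at h2
  -- assemble
  have h4 : |(∫ y, θ.normed volume y * pr (x₀ - y)) - c| ≤
      BΘ * (volume.real B) ^ (2 / 3 : ℝ) * (M : ℝ) := by
    calc |(∫ y, θ.normed volume y * pr (x₀ - y)) - c| ≤ BΘ * ∫ y in B, |Q y| := h1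
      _ ≤ BΘ * ((volume.real B) ^ (2 / 3 : ℝ) * (M : ℝ)) := mul_le_mul_of_nonneg_left h2 hBΘ0
      _ = BΘ * (volume.real B) ^ (2 / 3 : ℝ) * (M : ℝ) := by ring
  rw [Real.enorm_eq_ofReal_abs, ← hMeq, ← ENNReal.ofReal_coe_nnreal, ← ENNReal.ofReal_mul (by positivity)]
  exact ENNReal.ofReal_le_ofReal h4

/-! ### The local slice estimate -/

/-- **The local slice estimate.** If `pr = Q + c` a.e., then on every measurable set `E`
`∫_E (|v|³ + |pr|^{3/2}) ≤ (∫_E |v|⁶)^{1/2} |E|^{1/2} + √2 ((∫_E |Q|³)^{1/2} |E|^{1/2} + |c|^{3/2} |E|)`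
— every term sees `v` and `Q` only ON `E`. -/
theorem setLIntegral_cube_add_pressure_le_local
    {v : EuclideanSpace ℝ (Fin 3) → EuclideanSpace ℝ (Fin 3)} {pr Q : EuclideanSpace ℝ (Fin 3) → ℝ}
    {c : ℝ} (hv : AEStronglyMeasurable v volume) (hQ : AEStronglyMeasurable Q volume)
    (hae : ∀ᵐ x ∂(volume : Measure (EuclideanSpace ℝ (Fin 3))), pr x = Q x + c)
    (E : Set (EuclideanSpace ℝ (Fin 3))) :
    ∫⁻ x in E, (‖v x‖ₑ ^ (3 : ℕ) + ‖pr x‖ₑ ^ (3 / 2 : ℝ)) ≤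
      (∫⁻ x in E, ‖v x‖ₑ ^ 6) ^ (1 / 2 : ℝ) * (volume E) ^ (1 / 2 : ℝ) +
        (2 : ℝ≥0∞) ^ (1 / 2 : ℝ) *
          ((∫⁻ x in E, ‖Q x‖ₑ ^ (3 : ℝ)) ^ (1 / 2 : ℝ) * (volume E) ^ (1 / 2 : ℝ) +
            ‖c‖ₑ ^ (3 / 2 : ℝ) * volume E) := by
  have hv3 : AEMeasurable (fun x => ‖v x‖ₑ ^ (3 : ℕ)) (volume.restrict E) :=
    (hv.enorm.pow_const 3).restrict
  have hQ32 : AEMeasurable (fun x => ‖Q x‖ₑ ^ (3 / 2 : ℝ)) (volume.restrict E) :=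
    (hQ.enorm.pow_const _).restrict
  -- velocity
  have h1 : ∫⁻ x in E, ‖v x‖ₑ ^ (3 : ℕ) ≤
      (∫⁻ x in E, ‖v x‖ₑ ^ 6) ^ (1 / 2 : ℝ) * (volume E) ^ (1 / 2 : ℝ) := by
    refine (setLIntegral_le_sqrt_mul_sqrt hv3).trans (le_of_eq ?_)
    congr 2
    refine lintegral_congr fun x => ?_
    rw [ENNReal.rpow_two, ← pow_mul]
  -- pressure, pointwise
  have hae' : ∀ᵐ x ∂(volume.restrict E), ‖pr x‖ₑ ^ (3 / 2 : ℝ) ≤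
      (2 : ℝ≥0∞) ^ (1 / 2 : ℝ) * (‖Q x‖ₑ ^ (3 / 2 : ℝ) + ‖c‖ₑ ^ (3 / 2 : ℝ)) := by
    filter_upwards [ae_restrict_of_ae hae] with x hx
    rw [hx]
    calc ‖Q x + c‖ₑ ^ (3 / 2 : ℝ) ≤ (‖Q x‖ₑ + ‖c‖ₑ) ^ (3 / 2 : ℝ) := by
          gcongr
          exact enorm_add_le _ _
      _ ≤ (2 : ℝ≥0∞) ^ ((3 / 2 : ℝ) - 1) * (‖Q x‖ₑ ^ (3 / 2 : ℝ) + ‖c‖ₑ ^ (3 / 2 : ℝ)) :=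
          ENNReal.rpow_add_le_mul_rpow_add_rpow _ _ (by norm_num)
      _ = (2 : ℝ≥0∞) ^ (1 / 2 : ℝ) * (‖Q x‖ₑ ^ (3 / 2 : ℝ) + ‖c‖ₑ ^ (3 / 2 : ℝ)) := by
          norm_num
  have h2 : ∫⁻ x in E, ‖Q x‖ₑ ^ (3 / 2 : ℝ) ≤
      (∫⁻ x in E, ‖Q x‖ₑ ^ (3 : ℝ)) ^ (1 / 2 : ℝ) * (volume E) ^ (1 / 2 : ℝ) := by
    refine (setLIntegral_le_sqrt_mul_sqrt hQ32).trans (le_of_eq ?_)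
    congr 2
    refine lintegral_congr fun x => ?_
    rw [← ENNReal.rpow_mul]
    norm_num
  have h3 : ∫⁻ x in E, ‖pr x‖ₑ ^ (3 / 2 : ℝ) ≤
      (2 : ℝ≥0∞) ^ (1 / 2 : ℝ) *
        ((∫⁻ x in E, ‖Q x‖ₑ ^ (3 : ℝ)) ^ (1 / 2 : ℝ) * (volume E) ^ (1 / 2 : ℝ) +
          ‖c‖ₑ ^ (3 / 2 : ℝ) * volume E) := by
    calc ∫⁻ x in E, ‖pr x‖ₑ ^ (3 / 2 : ℝ)
        ≤ ∫⁻ x in E, (2 : ℝ≥0∞) ^ (1 / 2 : ℝ) * (‖Q x‖ₑ ^ (3 / 2 : ℝ) + ‖c‖ₑ ^ (3 / 2 : ℝ)) :=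
          lintegral_mono_ae hae'
      _ = (2 : ℝ≥0∞) ^ (1 / 2 : ℝ) *
            ((∫⁻ x in E, ‖Q x‖ₑ ^ (3 / 2 : ℝ)) + ∫⁻ _ in E, ‖c‖ₑ ^ (3 / 2 : ℝ)) := by
          rw [lintegral_const_mul' _ _ (by simp), lintegral_add_left' hQ32]
      _ ≤ _ := by
          rw [setLIntegral_const]
          gcongr
  calc ∫⁻ x in E, (‖v x‖ₑ ^ (3 : ℕ) + ‖pr x‖ₑ ^ (3 / 2 : ℝ))
      = (∫⁻ x in E, ‖v x‖ₑ ^ (3 : ℕ)) + ∫⁻ x in E, ‖pr x‖ₑ ^ (3 / 2 : ℝ) :=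
        lintegral_add_left' hv3 _
    _ ≤ _ := add_le_add h1 h3

/-! ### Measurability in time of the slice functionals -/

/-- A function continuous on the open slab `t < 0`, extended by `0`, is measurable. -/
theorem measurable_extendByZero_of_continuousOn {β : Type*} [TopologicalSpace β]
    [MeasurableSpace β] [BorelSpace β] [Zero β]
    {g : ℝ × EuclideanSpace ℝ (Fin 3) → β} (hg : ContinuousOn g (Iio 0 ×ˢ univ)) :
    Measurable (fun z : ℝ × EuclideanSpace ℝ (Fin 3) => if z.1 < 0 then g z else 0) := by
  refine measurable_of_restrict_of_restrict_compl
    (s := Iio (0 : ℝ) ×ˢ (univ : Set (EuclideanSpace ℝ (Fin 3))))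
    (measurableSet_Iio.prod MeasurableSet.univ) ?_ ?_
  · have hc : ContinuousOn (fun z : ℝ × EuclideanSpace ℝ (Fin 3) => if z.1 < 0 then g z else 0)
        (Iio 0 ×ˢ univ) := by
      refine hg.congr fun z hz => ?_
      have hz1 : z.1 < 0 := (mem_prod.1 hz).1
      simp only [hz1, if_true]
    exact hc.restrict.measurable
  · have h0 : (Iio (0 : ℝ) ×ˢ (univ : Set (EuclideanSpace ℝ (Fin 3))))ᶜ.restrict
        (fun z : ℝ × EuclideanSpace ℝ (Fin 3) => if z.1 < 0 then g z else 0) = fun _ => 0 := by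
      funext z
      have hz : ¬ (z : ℝ × EuclideanSpace ℝ (Fin 3)).1 < 0 := fun h => z.2 ⟨h, mem_univ _⟩
      simp only [restrict_apply, hz, if_false]
    rw [h0]
    exact measurable_const

/-- **Measurability in time of a slice integral over a fixed set**: for a measurable
`G : ℝ × ℝ³ → ℝ≥0∞`, `t ↦ ∫_B G(t, x) dx` is measurable. -/
theorem measurable_setLIntegral_slice {G : ℝ × EuclideanSpace ℝ (Fin 3) → ℝ≥0∞} (hG : Measurable G)
    (B : Set (EuclideanSpace ℝ (Fin 3))) :
    Measurable fun t : ℝ => ∫⁻ x in B, G (t, x) :=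
  hG.lintegral_prod_right' (ν := volume.restrict B)

end Summit.NavierStokesRegularity.NavierStokesRegularity.Theorems.FiniteDissipationLiouville.Birth.Apex

end
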